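import Literature.MathematicalPhysics.QuantumFieldTheory.Balaban1983to89.B13Lemma3TorusPrimitive
import Literature.MathematicalPhysics.QuantumFieldTheory.Balaban1983to89.B13Eq216AnalyticStep
import Literature.MathematicalPhysics.QuantumFieldTheory.Balaban1983to89.B13CovarianceDifference216

/-!
# `Balaban1983to89.B13PrimitiveKernels216` — T. Bałaban, *Renormalization group approach to lattice gauge field
theories. II. Cluster expansions*, Commun. Math. Phys. **116** (1988) 1–22 [Balaban1988RG2Cluster], pp. 13, 15–16: the
PRIMITIVE KERNEL INPUTS of Lemma 3 on the papers' periodic carrier, BY NAME — the seven by-assertion hypotheses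
`hG hΓ₀ hCs hC216` (uniform localisation of the one-step kernels `Γ_k(Z₀,σ)`, `Γ_k(Z₀,0)`, `C^{(k)}(Z₀,σ)`,
`C^{(k)}(Z₀,0)`; cell locus L17a) and `hdΓ hdC hdE` (the (2.16)-type bounds of their σ-differences; cell locus L16a) of
`B13Lemma3TorusPrimitive.h226_torus_of_primitives` packaged as TWO NAMED HYPOTHESES `Localisation17a` and
`Differences216`, the torus-model capstone restated over them (`h226_torus_of_kernelBounds`), and the printed
TWO-PART STRUCTURE of (2.16) — «O(1)e^{−⅓δ₀M}» (the σ-part, from the M-cube generalized random walk expansions of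
[13]: a hypothesis) «+ O(α₀ + α₁)» (the (𝐔, 𝐉)-part, from analyticity on the bigger space: DERIVED, Schwarz lemma,
`B13Eq216AnalyticStep.entry_sub_le_of_differentiableOn`) — as the theorem `differences216_of_analytic` producing
`Differences216` (and `localisation17a_of_majorants` producing `Localisation17a`) from exactly: the σ-part bounds at
the reference configuration, and joint analyticity in the configuration parameter with uniform torus-localised
majorants on the σ-polydisc `|σ| ≤ e^{κ₁}`

statement-level skeleton of published theorems with citation tags; proofs where landed; nothing here is a claim about
the Yang–Mills mass gap

PDF held: `paper:balaban1988-cmp116-rg-ii-cluster` (journal page = PDF page + 0); p. 13 re-read this session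
(materialised `p0013.txt`, `lit read paper:balaban1988-cmp116-rg-ii-cluster --pages 13`); pp. 15–16 as quoted in
`B13Eq216AnalyticStep` / `B13Lemma3TorusPrimitive` (materialised `p0015.txt`/`p0016.txt` there).

CITATION HEADER (verbatim, p. 13 [PDF 13]): *"For this class of localization domains we construct the generalized random
walk expansions. This construction was discussed in [13] for all operators determining Δ_k, and for C^{(k)}(Z₀), but
not for (C^{(k)})^{1/2}. To expand the last operator we use a method similar to the method of Sect. C [16]. … The
operator G₃(x) has the same properties as G₂, especially it can be expanded into a generalized random walk expansion.
This yields an expansion of the integral above, hence an expansion of (C^{(k)})^{1/2} also."*; p. 15 [PDF 15]: *"The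
quadratic forms and covariances in H(Z) are analytic functions on the space of configurations (U, J) satisfying the
conditions I.(i)–(iii) on the domain Z, with constants α′₀, α′₁ much bigger than α₀, α₁, therefore we can restrict them,
as analytic functions, to the above subspace. … For the pair (U, 0) the operators are symmetric, and the measure is
positive, and then the estimates are simpler. The general case is handled by a perturbative argument."*; p. 16 [PDF 16]:
*"In the expression on the right-hand side we replace the operators by the corresponding operators with σ(Z) = 0,
𝐔 = U, 𝐉 = 0, and we estimate the error. For the quadratic form in the first exponential the difference is a quadratic
form ½⟨X, R₁X⟩, with matrix elements satisfying the bound* `|R₁(b, b′)| ≦ (O(1)e^{−⅓δ₀M} + O(α₀ + α₁)) exp(−½δ₀|b₋ − b′₋|).`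
(2.16)".

WHAT IS REPRODUCED (cell `pub-balaban-gaps`, planner seat g1-plan-1 (lens analytic ∕ RG bookkeeping), skeleton #4 — the
FIRST MISSING ESTIMATE of binder (D4), node A.4 = (T3), BY NAME; filed by prover seat g1-p2 gen 2 per the cell lead's
ruling R9 with §4 added (the reduction of L16a to TWO primitive fields, `B13CovarianceDifference216`)):
* §1 `Localisation17a` — the named hypothesis (a `structure … : Prop`, four fields = the binders `hG hΓ₀ hCs hC216` of
  `h226_torus_of_primitives` VERBATIM): on the σ-polydisc `∀ j, ‖σ j‖ ≤ e^{κ₁}` the kernels `G(σ)` (of `X ↦ Γ_k(Z₀,σ)X`),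
  `Γ₀`, `A(σ)⁻¹` (`= C^{(k)}(Z₀,σ)`), `C` are bounded entrywise by `K·e^{−κ·d₁(b,j)}` in the ℓ¹ distance of the site
  torus `UT Nf` carrying the bond locations; `Differences216` — the named hypothesis (three fields = `hdΓ hdC hdE`
  VERBATIM): the σ-differences `G(σ) − Γ₀`, `A(σ)⁻¹ − C`, `A(σ) − C⁻¹` obey the (2.16) shape with constants
  `θ_Γ, θ_C, θ_E` at the same rate.
* §2 `h226_torus_of_kernelBounds` — `h226_torus_of_primitives` with its seven kernel-bound binders replaced by
  `(h17 : Localisation17a …) (h16 : Differences216 …)`; a pure re-binding (the proof is that theorem).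
* §3 `sub_ref_le_of_analytic` — the two-part split of `B13Eq216AnalyticStep.h216_split` for an ARBITRARY non-negative
  weight (so that it serves the torus distance): σ-part `θ_σ·g` at the reference configuration + entrywise analyticity
  in `u` on the `R`-ball with the uniform majorant `θ₀·g` ⟹ `‖(K u − K_ref)(i,j)‖ ≤ (θ_σ + 2θ₀α/R)·g(i,j)` at
  `‖u‖ ≤ α < R`; `localisation17a_of_majorants` — `Localisation17a` at the actual configuration `u` (inside the
  `R`-ball) from the uniform majorants and the reference identities `G(0,0) = Γ₀`, `A(0,0)⁻¹ = C` (*"For the pair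
  (U, 0) the operators are symmetric"*), with `K_Γ = K_G`, `K₀ = K_Cs`; `differences216_of_analytic` —
  `Differences216` at `u` with the printed two-part constants `θ_• = θ_σ,• + 2K_•α/R` from (T3a) the three σ-part
  bounds at `u = 0` (HYPOTHESES: print «O(1)e^{−⅓δ₀M}», the M-cube random walk expansions of p. 13 / [13] — no printed
  derivation in the series, lit-balaban r10 `B13-CLOSURE.md` §3) and (T3b) joint analyticity of `u ↦ G(σ,u)`,
  `u ↦ A(σ,u)⁻¹`, `u ↦ A(σ,u)` on the `R`-ball with uniform torus-localised majorants `K_G, K_Cs, K_E` on the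
  σ-polydisc (HYPOTHESES: p. 15 + [13] = CMP **99** Thm 3.15 / 3.10 in a complex background, typed by name as
  `B9.Thm315Printed`, `B9.Thm310Printed`, `B9.Thm315FullPrinted`; cell GAPS G-B9-10).
* §4 (prover seat g1-p2) `localisation17a_mono_rate`, `differences216_mono_rate`; **`differences216_of_two`** —
  `Differences216` from `Localisation17a` and only TWO difference bounds (`hdΓ`, `hdE`): the covariance field `hdC` is
  DERIVED by the resolvent identity `A(σ)⁻¹ − C = −A(σ)⁻¹(A(σ) − C⁻¹)C` (`B13CovarianceDifference216.hdC_of_hdE`) at a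
  twice-dropped rate — the cell's (T3a) has two independent σ-part inputs, not three, given L17a.
RG BOOKKEEPING (why two structures and not seven binders).  Binder (D4) consumes Lemma 3 at EVERY scale `k` and history
`p ∈ HistBox γ₀ k` through `Summit…Gaps.D4NodeO.Lemma3Family` / `D4NodeA.h238_of_termwise`; the scale enters
`h226_torus_of_kernelBounds` ONLY through the objects `(A, Γ, G, C, Γ₀)` of the term and through the `|P|`-rate
`a = γ₂ε₁²/g_k(p)²` (antitone, one numerics witness per box — `D4NodeA.termwise226_anti`), so k-UNIFORMITY of (D4)'s
inputs = ONE tuple `(κ, K_G, K_Γ, K_Cs, K₀, θ_Γ, θ_C, θ_E)` serving `Localisation17a ∧ Differences216` for all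
`k, p, n, Z, t` — [9] Sect. A's «constants uniform in k» (asserted there, not proved; NODE O.2 (v)) is exactly the
existential over this tuple, nothing else.
HONEST SCOPE.  Re-binding + the Schwarz-lemma split only; no operator of [13]/[15] is constructed, no random walk
expansion is performed, the σ-parts and the analytic majorants are hypotheses, and whether Bałaban's `H(Z)` is
termwise dominated by (2.14)-terms is the separate hypothesis `TermDomination` of the (D4) joiner.  NOT continuum,
NOT Clay; nothing of Bałaban's asserted beyond print.  No `sorry`, no new definition of an object (two hypothesis-shape
`structure … : Prop`, D-0026: named hypothesis shapes, Literature side), no new named fact.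
-/

namespace Literature.MathematicalPhysics.QuantumFieldTheory.Balaban1983to89.B13PrimitiveKernels216

open Metric Set Matrix
open Literature.MathematicalPhysics.QuantumFieldTheory.Balaban1983to89
open Literature.MathematicalPhysics.QuantumFieldTheory.Balaban1983to89.TreeLengthTorus (TPt TDom tsys)
open Literature.MathematicalPhysics.QuantumFieldTheory.Balaban1983to89.TreeLengthTorusTransfer (tclosure)
open Literature.MathematicalPhysics.QuantumFieldTheory.Balaban1983to89.B13Lemma3TorusData (TBond)
open Literature.MathematicalPhysics.QuantumFieldTheory.Balaban1983to89.B13Lemma3TorusTerms (weight Z0)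
open Literature.MathematicalPhysics.QuantumFieldTheory.Balaban1983to89.B13Term214 (term214 SepHolOn core214 F214)
open Literature.MathematicalPhysics.QuantumFieldTheory.Balaban1983to89.B13Bound143 (invTau)
open Literature.MathematicalPhysics.QuantumFieldTheory.Balaban1983to89.B5TorusCover (UT)
open Literature.MathematicalPhysics.QuantumFieldTheory.Balaban1983to89.B9Thm37GlueTorus (tdist1 tdist1_nonneg)
open Literature.MathematicalPhysics.QuantumFieldTheory.Balaban1983to89.B13Lemma3TorusPrimitive
  (h226_torus_of_primitives)
open Literature.MathematicalPhysics.QuantumFieldTheory.Balaban1983to89.B13Eq216AnalyticStep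
  (entry_sub_le_of_differentiableOn)
open Literature.MathematicalPhysics.QuantumFieldTheory.Balaban1983to89.B13CovarianceDifference216 (hdC_of_hdE)

noncomputable section

/-! ## §1. The two named hypotheses: uniform localisation (L17a) and the (2.16)-type σ-differences (L16a) -/

section Named

variable {d N' : ℕ} {ν : ℕ} {Nf : Fin ν → ℕ} [∀ i, NeZero (Nf i)]
variable {Λ : Type} [Fintype Λ] [DecidableEq Λ] {C₀ : Type}

/-- **L17a — UNIFORM LOCALISATION of the primitive one-step kernels** (named hypothesis; the binders `hG hΓ₀ hCs hC216`
of `B13Lemma3TorusPrimitive.h226_torus_of_primitives` verbatim): for every σ of the polydisc `‖σ_j‖ ≤ e^{κ₁}` the kernel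
`G(σ)` of the linear operator `X ↦ Γ_k(Z₀,σ)X`, its reference value `Γ₀ = Γ_k(Z₀,0)` at `(U,0)`, the covariance
`A(σ)⁻¹ = C^{(k)}(Z₀,σ)` and its reference value `C = C^{(k)}(Z₀,0)` are bounded entrywise by `K·e^{−κ·d₁(b,j)}`, the
bonds being located on the site torus `UT Nf` (ℓ¹ torus distance).  Printed support: p. 13 (generalized random walk
expansions *"discussed in [13] for all operators determining Δ_k, and for C^{(k)}(Z₀)"*, `(C^{(k)})^{1/2}` *"by a method
similar to … Sect. C [16]"*) — [13] = CMP 99 Thm 3.15 / 3.10 (`B9.Thm315Printed`, `B9.Thm310Printed`); asserted for the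
complex backgrounds and decoupling parameters of §2, not derived there (cell GAPS G-B9-10, locus L17a).
[cite: Balaban1988RG2Cluster, p.13, p.15, (2.16) p.16] -/
structure Localisation17a (c : B13.Consts) (A : (TPt d N' → ℂ) → Matrix Λ Λ ℂ)
    (G : (TPt d N' → ℂ) → Matrix Λ (Λ ⊕ C₀) ℂ) (Γ₀ : Matrix Λ (Λ ⊕ C₀) ℝ) (C : Matrix Λ Λ ℝ)
    (locΛ : Λ → UT Nf) (locN : Λ ⊕ C₀ → UT Nf) (kap KG KΓ KCs K₀ : ℝ) : Prop where
  hG : ∀ σ : TPt d N' → ℂ, (∀ j, ‖σ j‖ ≤ Real.exp c.κ₁) →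
    ∀ b j, ‖G σ b j‖ ≤ KG * Real.exp (-(kap * tdist1 Nf (locΛ b) (locN j)))
  hΓ₀ : ∀ b j, ‖Γ₀ b j‖ ≤ KΓ * Real.exp (-(kap * tdist1 Nf (locΛ b) (locN j)))
  hCs : ∀ σ : TPt d N' → ℂ, (∀ j, ‖σ j‖ ≤ Real.exp c.κ₁) →
    ∀ b b', ‖(A σ)⁻¹ b b'‖ ≤ KCs * Real.exp (-(kap * tdist1 Nf (locΛ b) (locΛ b')))
  hC216 : ∀ b b', ‖C b b'‖ ≤ K₀ * Real.exp (-(kap * tdist1 Nf (locΛ b) (locΛ b')))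

/-- **L16a — the (2.16)-type bounds of the σ-DIFFERENCES of the primitive kernels** (named hypothesis; the binders
`hdΓ hdC hdE` of `B13Lemma3TorusPrimitive.h226_torus_of_primitives` verbatim): on the polydisc `‖σ_j‖ ≤ e^{κ₁}` the
differences `G(σ) − Γ₀` (the kernel of `R₃`), `A(σ)⁻¹ − C` and `A(σ) − C⁻¹` (the kernel `E(σ)` of `R₁`'s covariance part)
obey the entrywise shape (2.16) `θ·e^{−κ·d₁(b,j)}` with constants `θ_Γ, θ_C, θ_E` — print: *"with matrix elements
satisfying the bound (2.16)"*, `θ = O(1)e^{−⅓δ₀M} + O(α₀ + α₁)`, ASSERTED (no printed derivation of the σ-part in the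
series; the `O(α₀ + α₁)` part is the Schwarz-lemma step of `B13Eq216AnalyticStep`, cf. `differences216_of_analytic`
below; cell locus L16a, GAPS G-B13-09). [cite: Balaban1988RG2Cluster, (2.16) p.16, p.15] -/
structure Differences216 (c : B13.Consts) (A : (TPt d N' → ℂ) → Matrix Λ Λ ℂ)
    (G : (TPt d N' → ℂ) → Matrix Λ (Λ ⊕ C₀) ℂ) (Γ₀ : Matrix Λ (Λ ⊕ C₀) ℝ) (C : Matrix Λ Λ ℝ)
    (locΛ : Λ → UT Nf) (locN : Λ ⊕ C₀ → UT Nf) (kap θΓ θC θE : ℝ) : Prop where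
  hdΓ : ∀ σ : TPt d N' → ℂ, (∀ j, ‖σ j‖ ≤ Real.exp c.κ₁) →
    ∀ b j, ‖(G σ - Γ₀.map (algebraMap ℝ ℂ)) b j‖ ≤ θΓ * Real.exp (-(kap * tdist1 Nf (locΛ b) (locN j)))
  hdC : ∀ σ : TPt d N' → ℂ, (∀ j, ‖σ j‖ ≤ Real.exp c.κ₁) →
    ∀ b b', ‖((A σ)⁻¹ - C.map (algebraMap ℝ ℂ)) b b'‖ ≤ θC * Real.exp (-(kap * tdist1 Nf (locΛ b) (locΛ b')))
  hdE : ∀ σ : TPt d N' → ℂ, (∀ j, ‖σ j‖ ≤ Real.exp c.κ₁) →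
    ∀ b b', ‖(A σ - C⁻¹.map (algebraMap ℝ ℂ)) b b'‖ ≤ θE * Real.exp (-(kap * tdist1 Nf (locΛ b) (locΛ b')))

end Named

/-! ## §2. (2.26) for one term of the torus model from the two named hypotheses -/

section Joiner

variable {d L N' : ℕ} [NeZero L] [NeZero N'] {M : ℕ}
variable {ν : ℕ} {Nf : Fin ν → ℕ} [∀ i, NeZero (Nf i)]
variable {Λ : Type} [Fintype Λ] [DecidableEq Λ] {C₀ : Type} [Fintype C₀] [DecidableEq C₀]

open Classical in
/-- **(2.26) FOR ONE TERM of the torus model from `Localisation17a ∧ Differences216`** —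
`B13Lemma3TorusPrimitive.h226_torus_of_primitives` with its seven kernel-bound binders `hG hΓ₀ hCs hC216 hdΓ hdC hdE`
replaced by the two named hypotheses of §1 (every other binder unchanged and in the same order): the term
`(𝐃, P) = t` of `H(Z)` in its (2.14)-form obeys `‖(2.14)‖ ≤ weight L M c Z a t · exp(a₅·|Z|)`.  Downstream (unchanged,
kernel-checked in the tree): `B13Lemma3TorusTerms.hrep_of_termwise` → `B13Lemma3Torus.bound238With_torus` = Lemma 3
(2.38) on the carrier. [cite: Balaban1988RG2Cluster, (2.14)–(2.16) pp.15–16, (2.26) p.17, (2.38) p.20] -/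
theorem h226_torus_of_kernelBounds (c : B13.Consts) (hκ₁ : 1 ≤ c.κ₁) (hα₆ : c.α₆ ≠ 0)
    (Z : TDom d N') (t : Finset (TDom d (L * N')) × Finset (TBond d M (L * N')))
    (hpos : ∀ Y : TDom d (L * N'), 0 < invTau c ((tsys d (L * N')).dj Y))
    (hhalf : ∀ Y : TDom d (L * N'), invTau c ((tsys d (L * N')).dj Y) ≤ 1 / 2)
    {Uσ Uτ : Set ℂ} (hUσ : IsOpen Uσ) (hUτ : IsOpen Uτ) (hUexp : closedBall (0 : ℂ) (Real.exp c.κ₁) ⊆ Uσ)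
    (hUtau : ∀ Y : TDom d (L * N'), closedBall (0 : ℂ) ((invTau c ((tsys d (L * N')).dj Y))⁻¹) ⊆ Uτ)
    {r : ℝ} (hr : 0 < r) (hr' : r ≤ Real.exp c.κ₁ - 1)
    (hsubτ : ∀ s ∈ Set.uIcc (0 : ℝ) 1, closedBall (s : ℂ) r ⊆ Uτ)
    (lZ : List (TPt d N')) (hlZ : lZ.Nodup ∧ lZ.toFinset = Z.1 \ tclosure L N' (Z0 M t))
    (lD : List (TDom d (L * N'))) (hlD : lD.Nodup ∧ lD.toFinset = t.1)
    (A : (TPt d N' → ℂ) → Matrix Λ Λ ℂ) (Γ : (TPt d N' → ℂ) → (Λ ⊕ C₀ → ℝ) → (Λ → ℂ))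
    (χY₀ χcP : (Λ → ℝ) → ℝ) (hχ0 : ∀ B, 0 ≤ χY₀ B) (hχc0 : ∀ B, 0 ≤ χcP B) (Dfam : Finset (TDom d (L * N')))
    (V : TDom d (L * N') → (Λ → ℝ) → ℂ)
    (hΨσ : ∀ τ : TDom d (L * N') → ℂ, (∀ j, τ j ∈ Uτ) →
      SepHolOn Uσ (fun σ => core214 A Γ (F214 t.2.card χY₀ χcP Dfam V) σ τ))
    (hΨτ : ∀ σ : TPt d N' → ℂ, (∀ j, σ j ∈ Uσ) →
      SepHolOn Uτ (fun τ => core214 A Γ (F214 t.2.card χY₀ χcP Dfam V) σ τ))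
    {C : Matrix Λ Λ ℝ} (hC : C.PosDef) (Γ₀ : Matrix Λ (Λ ⊕ C₀) ℝ)
    (hAs : ∀ σ : TPt d N' → ℂ, (∀ j, ‖σ j‖ ≤ Real.exp c.κ₁) → (A σ).IsSymm)
    (hA : ∀ σ : TPt d N' → ℂ, (∀ j, ‖σ j‖ ≤ Real.exp c.κ₁) → ((A σ).map Complex.re).PosDef)
    (G : (TPt d N' → ℂ) → Matrix Λ (Λ ⊕ C₀) ℂ)
    (hlin : ∀ σ : TPt d N' → ℂ, (∀ j, ‖σ j‖ ≤ Real.exp c.κ₁) →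
      ∀ X : Λ ⊕ C₀ → ℝ, Γ σ X = G σ *ᵥ fun j => (X j : ℂ))
    {γ₂ rP a₂₀ w : ℝ} (qP : (Λ → ℝ) → ℝ)
    (h222 : ∀ B, χY₀ B * χcP B ≤ Real.exp (-(γ₂ / 2 * rP ^ 2 * (t.2.card : ℕ)) + γ₂ / 2 * qP B)) (hγ₂ : 0 ≤ γ₂)
    (hqP : ∀ B, qP B ≤ B ⬝ᵥ B)
    (h220R : ∀ B, ∑ Y ∈ Dfam, (invTau c ((tsys d (L * N')).dj Y))⁻¹ * ‖V Y B‖ ≤ a₂₀ / 2 * (B ⬝ᵥ B) + w)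
    (ha0 : 0 ≤ a₂₀)
    (locΛ : Λ → UT Nf) (locN : Λ ⊕ C₀ → UT Nf) {m : ℕ}
    (hfibΛ : ∀ x : UT Nf, (Finset.univ.filter fun i => locΛ i = x).card ≤ m)
    (hfibN : ∀ x : UT Nf, (Finset.univ.filter fun j => locN j = x).card ≤ m)
    {kap kap' kap'' θ θE θΓ θC KG KΓ KCs K₀ : ℝ} (hkap'' : 0 < kap'') (h1 : kap'' < kap') (h2 : kap' < kap)
    (hθE : 0 ≤ θE) (hθΓ : 0 ≤ θΓ) (hθC : 0 ≤ θC) (hKG : 0 ≤ KG) (hKΓ : 0 ≤ KΓ) (hKCs : 0 ≤ KCs) (hK₀ : 0 ≤ K₀)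
    (hθEle : θE ≤ θ) (hθΓle : θΓ ≤ θ)
    (hθR1le : (m * (1 + 2 / (kap - kap')) ^ ν) * (m * (1 + 2 / (kap' - kap'')) ^ ν)
      * (θΓ * KCs * KG + KΓ * θC * KG + KΓ * K₀ * θΓ) ≤ θ)
    -- THE TWO NAMED HYPOTHESES (L17a, L16a)
    (h17 : Localisation17a c A G Γ₀ C locΛ locN kap KG KΓ KCs K₀)
    (h16 : Differences216 c A G Γ₀ C locΛ locN kap θΓ θC θE)
    (hsmallKθ : K₀ * (m * (1 + 2 / kap) ^ ν) * (θ * (m * (1 + 2 / kap'') ^ ν)) < 1)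
    {cE g : ℝ} (hc0 : 0 ≤ cE) (hc : ∀ k, hC.1.eigenvalues k ≤ cE)
    (hαc : (2 * (θ * (m * (1 + 2 / kap'') ^ ν)) + (γ₂ + a₂₀)) * cE ≤ 1 / 2) (hg : 0 ≤ g)
    (hΓq : ∀ X : Λ ⊕ C₀ → ℝ, (Γ₀ *ᵥ X) ⬝ᵥ (C *ᵥ (Γ₀ *ᵥ X)) ≤ g * (X ⬝ᵥ X))
    (hsmall : (2 * (θ * (m * (1 + 2 / kap'') ^ ν)) + (γ₂ + a₂₀)) * (1 + 2 * cE * g) ≤ 1 / 2)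
    {a a₅ : ℝ} (hPa : a ≤ γ₂ * rP ^ 2)
    (hvol : 2 * (K₀ * (m * (1 + 2 / kap) ^ ν) * (θ * (m * (1 + 2 / kap'') ^ ν))
              * (1 + (1 - K₀ * (m * (1 + 2 / kap) ^ ν) * (θ * (m * (1 + 2 / kap'') ^ ν)))⁻¹) / 2)
          * (Fintype.card Λ : ℝ)
        + w + (2 * (θ * (m * (1 + 2 / kap'') ^ ν)) + (γ₂ + a₂₀)) * cE * (Fintype.card Λ : ℝ)
        + (2 * (θ * (m * (1 + 2 / kap'') ^ ν)) + (γ₂ + a₂₀)) * (1 + 2 * cE * g) * (Fintype.card (Λ ⊕ C₀) : ℝ)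
        ≤ a₅ * ((Z.1).card : ℝ)) :
    ‖term214 r lZ lD (core214 A Γ (F214 t.2.card χY₀ χcP Dfam V)) 0 0‖ ≤
      weight L M c Z a t * Real.exp (a₅ * ((Z.1).card : ℝ)) :=
  h226_torus_of_primitives c hκ₁ hα₆ Z t hpos hhalf hUσ hUτ hUexp hUtau hr hr' hsubτ lZ hlZ lD hlD A Γ χY₀ χcP
    hχ0 hχc0 Dfam V hΨσ hΨτ hC Γ₀ hAs hA G hlin qP h222 hγ₂ hqP h220R ha0 locΛ locN hfibΛ hfibN hkap'' h1 h2 hθE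
    hθΓ hθC hKG hKΓ hKCs hK₀ hθEle hθΓle hθR1le h17.hG h17.hΓ₀ h17.hCs h17.hC216 h16.hdΓ h16.hdC h16.hdE hsmallKθ
    hc0 hc hαc hg hΓq hsmall hPa hvol

end Joiner

/-! ## §3. The printed two-part structure of (2.16): σ-part (hypothesis) + (𝐔, 𝐉)-part (analyticity, derived) -/

section Analytic

variable {E : Type*} [NormedAddCommGroup E] [NormedSpace ℂ E]

/-- **The two-part split for an arbitrary non-negative weight** (the torus-distance form of
`B13Eq216AnalyticStep.h216_split`): a kernel family `u ↦ K u` on the configuration space `E`, entrywise analytic on the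
ball `‖u‖ < R` with the uniform majorant `θ₀·g`, whose value at the reference configuration `u = 0` differs from the
reference kernel `K_ref` by at most `θ_σ·g` (the σ-part), differs from `K_ref` at every `‖u‖ ≤ α < R` by at most
`(θ_σ + 2θ₀α/R)·g` — the printed «O(1)e^{−⅓δ₀M} + O(α₀ + α₁)». [cite: Balaban1988RG2Cluster, (2.16) p.16, p.15] -/
theorem sub_ref_le_of_analytic {p n : Type*} {K : E → Matrix p n ℂ} {Kref : Matrix p n ℂ} {R θ₀ θσ α : ℝ}
    (hR : 0 < R) (hθ₀ : 0 ≤ θ₀) (hαR : α < R) {g : p → n → ℝ} (hg : ∀ i j, 0 ≤ g i j)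
    (hσ : ∀ i j, ‖(K 0 - Kref) i j‖ ≤ θσ * g i j)
    (ha : ∀ i j, DifferentiableOn ℂ (fun u => K u i j) (ball 0 R))
    (hm : ∀ u ∈ ball (0 : E) R, ∀ i j, ‖K u i j‖ ≤ θ₀ * g i j) {u : E} (hu : ‖u‖ ≤ α) (i : p) (j : n) :
    ‖(K u - Kref) i j‖ ≤ (θσ + 2 * θ₀ * α / R) * g i j := by
  have huR : u ∈ ball (0 : E) R := by rw [mem_ball, dist_zero_right]; exact hu.trans_lt hαR
  have h1 : ‖(K u - K 0) i j‖ ≤ 2 * θ₀ * α / R * g i j := by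
    refine (entry_sub_le_of_differentiableOn hR hg ha hm huR i j).trans ?_
    have hmono : 2 * θ₀ / R * ‖u‖ ≤ 2 * θ₀ * α / R :=
      (mul_le_mul_of_nonneg_left hu (by positivity : (0 : ℝ) ≤ 2 * θ₀ / R)).trans_eq (by ring)
    exact mul_le_mul_of_nonneg_right hmono (hg i j)
  have hsplit : (K u - Kref) i j = (K u - K 0) i j + (K 0 - Kref) i j := by
    simp only [Matrix.sub_apply]; ring
  rw [hsplit, add_mul, add_comm (θσ * _)]
  exact (norm_add_le _ _).trans (add_le_add h1 (hσ i j))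

variable {d N' : ℕ} {ν : ℕ} {Nf : Fin ν → ℕ} [∀ i, NeZero (Nf i)]
variable {Λ : Type} [Fintype Λ] [DecidableEq Λ] {C₀ : Type}

omit [NormedSpace ℂ E] in
/-- **`Localisation17a` at the actual configuration from the uniform majorants** (T3b ⟹ L17a): if the joint families
`G(σ,u)`, `A(σ,u)⁻¹` are bounded entrywise on (σ-polydisc) × (`R`-ball of the configuration space) by the uniform
torus-localised majorants `K_G·e^{−κd₁}`, `K_Cs·e^{−κd₁}`, and the reference values at `σ = 0`, `u = 0` (the pair
`(U, 0)`: *"the operators are symmetric, and the measure is positive"*) are the real kernels `Γ₀`, `C`, then at every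
configuration `u` of the ball the section `σ ↦ (A(σ,u), G(σ,u))` satisfies `Localisation17a` with
`(K_G, K_Γ, K_Cs, K₀) = (K_G, K_G, K_Cs, K_Cs)`. [cite: Balaban1988RG2Cluster, p.15, p.13] -/
theorem localisation17a_of_majorants (c : B13.Consts)
    (A2 : (TPt d N' → ℂ) → E → Matrix Λ Λ ℂ) (G2 : (TPt d N' → ℂ) → E → Matrix Λ (Λ ⊕ C₀) ℂ)
    {Γ₀ : Matrix Λ (Λ ⊕ C₀) ℝ} {C : Matrix Λ Λ ℝ} (locΛ : Λ → UT Nf) (locN : Λ ⊕ C₀ → UT Nf)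
    {R kap KG KCs : ℝ} (hR : 0 < R)
    (hG0 : G2 0 0 = Γ₀.map (algebraMap ℝ ℂ)) (hC0 : (A2 0 0)⁻¹ = C.map (algebraMap ℝ ℂ))
    (hmΓ : ∀ σ : TPt d N' → ℂ, (∀ j, ‖σ j‖ ≤ Real.exp c.κ₁) → ∀ u ∈ ball (0 : E) R,
      ∀ b j, ‖G2 σ u b j‖ ≤ KG * Real.exp (-(kap * tdist1 Nf (locΛ b) (locN j))))
    (hmC : ∀ σ : TPt d N' → ℂ, (∀ j, ‖σ j‖ ≤ Real.exp c.κ₁) → ∀ u ∈ ball (0 : E) R,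
      ∀ b b', ‖(A2 σ u)⁻¹ b b'‖ ≤ KCs * Real.exp (-(kap * tdist1 Nf (locΛ b) (locΛ b'))))
    {u : E} (hu : u ∈ ball (0 : E) R) :
    Localisation17a c (fun σ => A2 σ u) (fun σ => G2 σ u) Γ₀ C locΛ locN kap KG KG KCs KCs := by
  have h0 : ∀ j, ‖(0 : TPt d N' → ℂ) j‖ ≤ Real.exp c.κ₁ := fun _ => by
    rw [Pi.zero_apply, norm_zero]; exact (Real.exp_pos _).le
  refine ⟨fun σ hσ b j => hmΓ σ hσ u hu b j, fun b j => ?_, fun σ hσ b b' => hmC σ hσ u hu b b', fun b b' => ?_⟩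
  · have h := hmΓ 0 h0 0 (mem_ball_self hR) b j
    rwa [hG0, Matrix.map_apply, Complex.coe_algebraMap, Complex.norm_real] at h
  · have h := hmC 0 h0 0 (mem_ball_self hR) b b'
    rwa [hC0, Matrix.map_apply, Complex.coe_algebraMap, Complex.norm_real] at h

/-- **`Differences216` with the printed two-part constants** ((T3a) + (T3b) ⟹ L16a = (2.16)): for the joint families
`G(σ,u)` (kernel of `Γ_k(Z₀,σ,𝐔,𝐉)`), `A(σ,u)⁻¹` (`= C^{(k)}(Z₀,σ,𝐔,𝐉)`), `A(σ,u)`, with real reference values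
`G(0,0) = Γ₀`, `A(0,0)⁻¹ = C`, `A(0,0) = C⁻¹`, IF (T3a) the σ-PARTS at the reference configuration obey the (2.16)
shape with `θ_σ,Γ, θ_σ,C, θ_σ,E` (print: `O(1)e^{−⅓δ₀M}`, from the M-cube generalized random walk expansions of
p. 13 / [13] — HYPOTHESES) and (T3b) for every σ of the polydisc the three families are entrywise analytic in `u` on
the ball `‖u‖ < R` (print: the bigger space with constants `α′₀, α′₁`) with the uniform torus-localised majorants
`K_G, K_Cs, K_E` (HYPOTHESES: [13] Thm 3.15-type in a complex background), THEN at every configuration `‖u‖ ≤ α < R` the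
section `σ ↦ (A(σ,u), G(σ,u))` satisfies `Differences216` with
`(θ_Γ, θ_C, θ_E) = (θ_σ,Γ + 2K_Gα/R, θ_σ,C + 2K_Csα/R, θ_σ,E + 2K_Eα/R)` — the printed
`O(1)e^{−⅓δ₀M} + O(α₀ + α₁)`, by the Schwarz lemma (`sub_ref_le_of_analytic`).
[cite: Balaban1988RG2Cluster, (2.16) p.16, p.15, p.13] -/
theorem differences216_of_analytic (c : B13.Consts)
    (A2 : (TPt d N' → ℂ) → E → Matrix Λ Λ ℂ) (G2 : (TPt d N' → ℂ) → E → Matrix Λ (Λ ⊕ C₀) ℂ)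
    {Γ₀ : Matrix Λ (Λ ⊕ C₀) ℝ} {C : Matrix Λ Λ ℝ} (locΛ : Λ → UT Nf) (locN : Λ ⊕ C₀ → UT Nf)
    {R α kap KG KCs KE θσΓ θσC θσE : ℝ} (hR : 0 < R) (hαR : α < R)
    (hKG : 0 ≤ KG) (hKCs : 0 ≤ KCs) (hKE : 0 ≤ KE)
    (hG0 : G2 0 0 = Γ₀.map (algebraMap ℝ ℂ)) (hC0 : (A2 0 0)⁻¹ = C.map (algebraMap ℝ ℂ))
    (hE0 : A2 0 0 = C⁻¹.map (algebraMap ℝ ℂ))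
    -- (T3a) the σ-parts at the reference configuration (print «O(1)e^{−⅓δ₀M}»; hypotheses)
    (hσΓ : ∀ σ : TPt d N' → ℂ, (∀ j, ‖σ j‖ ≤ Real.exp c.κ₁) →
      ∀ b j, ‖(G2 σ 0 - G2 0 0) b j‖ ≤ θσΓ * Real.exp (-(kap * tdist1 Nf (locΛ b) (locN j))))
    (hσC : ∀ σ : TPt d N' → ℂ, (∀ j, ‖σ j‖ ≤ Real.exp c.κ₁) →
      ∀ b b', ‖((A2 σ 0)⁻¹ - (A2 0 0)⁻¹) b b'‖ ≤ θσC * Real.exp (-(kap * tdist1 Nf (locΛ b) (locΛ b'))))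
    (hσE : ∀ σ : TPt d N' → ℂ, (∀ j, ‖σ j‖ ≤ Real.exp c.κ₁) →
      ∀ b b', ‖(A2 σ 0 - A2 0 0) b b'‖ ≤ θσE * Real.exp (-(kap * tdist1 Nf (locΛ b) (locΛ b'))))
    -- (T3b) analyticity in the configuration on the bigger space, with uniform localised majorants (hypotheses)
    (haΓ : ∀ σ : TPt d N' → ℂ, (∀ j, ‖σ j‖ ≤ Real.exp c.κ₁) →
      ∀ b j, DifferentiableOn ℂ (fun u => G2 σ u b j) (ball 0 R))
    (hmΓ : ∀ σ : TPt d N' → ℂ, (∀ j, ‖σ j‖ ≤ Real.exp c.κ₁) → ∀ u ∈ ball (0 : E) R,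
      ∀ b j, ‖G2 σ u b j‖ ≤ KG * Real.exp (-(kap * tdist1 Nf (locΛ b) (locN j))))
    (haC : ∀ σ : TPt d N' → ℂ, (∀ j, ‖σ j‖ ≤ Real.exp c.κ₁) →
      ∀ b b', DifferentiableOn ℂ (fun u => (A2 σ u)⁻¹ b b') (ball 0 R))
    (hmC : ∀ σ : TPt d N' → ℂ, (∀ j, ‖σ j‖ ≤ Real.exp c.κ₁) → ∀ u ∈ ball (0 : E) R,
      ∀ b b', ‖(A2 σ u)⁻¹ b b'‖ ≤ KCs * Real.exp (-(kap * tdist1 Nf (locΛ b) (locΛ b'))))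
    (haE : ∀ σ : TPt d N' → ℂ, (∀ j, ‖σ j‖ ≤ Real.exp c.κ₁) →
      ∀ b b', DifferentiableOn ℂ (fun u => A2 σ u b b') (ball 0 R))
    (hmE : ∀ σ : TPt d N' → ℂ, (∀ j, ‖σ j‖ ≤ Real.exp c.κ₁) → ∀ u ∈ ball (0 : E) R,
      ∀ b b', ‖A2 σ u b b'‖ ≤ KE * Real.exp (-(kap * tdist1 Nf (locΛ b) (locΛ b'))))
    {u : E} (hu : ‖u‖ ≤ α) :
    Differences216 c (fun σ => A2 σ u) (fun σ => G2 σ u) Γ₀ C locΛ locN kap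
      (θσΓ + 2 * KG * α / R) (θσC + 2 * KCs * α / R) (θσE + 2 * KE * α / R) := by
  refine ⟨fun σ hσ b j => ?_, fun σ hσ b b' => ?_, fun σ hσ b b' => ?_⟩
  · have hσ' : ∀ b j, ‖(G2 σ 0 - Γ₀.map (algebraMap ℝ ℂ)) b j‖
        ≤ θσΓ * Real.exp (-(kap * tdist1 Nf (locΛ b) (locN j))) := by
      rw [← hG0]; exact hσΓ σ hσ
    exact sub_ref_le_of_analytic (K := G2 σ) hR hKG hαR (fun b j => (Real.exp_pos _).le) hσ' (haΓ σ hσ)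
      (hmΓ σ hσ) hu b j
  · have hσ' : ∀ b b', ‖((fun u => (A2 σ u)⁻¹) 0 - C.map (algebraMap ℝ ℂ)) b b'‖
        ≤ θσC * Real.exp (-(kap * tdist1 Nf (locΛ b) (locΛ b'))) := by
      rw [← hC0]; exact hσC σ hσ
    exact sub_ref_le_of_analytic (K := fun u => (A2 σ u)⁻¹) hR hKCs hαR (fun b b' => (Real.exp_pos _).le) hσ'
      (haC σ hσ) (hmC σ hσ) hu b b'
  · have hσ' : ∀ b b', ‖(A2 σ 0 - C⁻¹.map (algebraMap ℝ ℂ)) b b'‖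
        ≤ θσE * Real.exp (-(kap * tdist1 Nf (locΛ b) (locΛ b'))) := by
      rw [← hE0]; exact hσE σ hσ
    exact sub_ref_le_of_analytic (K := A2 σ) hR hKE hαR (fun b b' => (Real.exp_pos _).le) hσ' (haE σ hσ)
      (hmE σ hσ) hu b b'

end Analytic

/-! ## §4. Rate monotonicity; `Differences216` from TWO difference bounds (the covariance field derived) -/

section TwoFields

variable {d N' : ℕ} {ν : ℕ} {Nf : Fin ν → ℕ} [∀ i, NeZero (Nf i)]
variable {Λ : Type} [Fintype Λ] [DecidableEq Λ] {C₀ : Type}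

/-- A torus-localised bound persists at any smaller rate. [folklore] [cite: Balaban1988RG2Cluster, (2.16) p.16] -/
private theorem mono_rate {p n R : Type*} [SeminormedAddCommGroup R] {P : Matrix p n R} {K kap kap' : ℝ}
    (hK : 0 ≤ K) (hle : kap' ≤ kap) (locp : p → UT Nf) (locn : n → UT Nf)
    (hP : ∀ i j, ‖P i j‖ ≤ K * Real.exp (-(kap * tdist1 Nf (locp i) (locn j)))) (i : p) (j : n) :
    ‖P i j‖ ≤ K * Real.exp (-(kap' * tdist1 Nf (locp i) (locn j))) := (hP i j).trans (mul_le_mul_of_nonneg_left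
  (Real.exp_le_exp.2 (neg_le_neg (mul_le_mul_of_nonneg_right hle (tdist1_nonneg _ _)))) hK)

/-- `Localisation17a` persists at any smaller rate (non-negative constants). [cite: Balaban1988RG2Cluster, p.13, (2.16) p.16] -/
theorem localisation17a_mono_rate {c : B13.Consts} {A : (TPt d N' → ℂ) → Matrix Λ Λ ℂ}
    {G : (TPt d N' → ℂ) → Matrix Λ (Λ ⊕ C₀) ℂ} {Γ₀ : Matrix Λ (Λ ⊕ C₀) ℝ} {C : Matrix Λ Λ ℝ} {locΛ : Λ → UT Nf}
    {locN : Λ ⊕ C₀ → UT Nf} {kap kap' KG KΓ KCs K₀ : ℝ} (hle : kap' ≤ kap) (hKG : 0 ≤ KG) (hKΓ : 0 ≤ KΓ)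
    (hKCs : 0 ≤ KCs) (hK₀ : 0 ≤ K₀) (h17 : Localisation17a c A G Γ₀ C locΛ locN kap KG KΓ KCs K₀) :
    Localisation17a c A G Γ₀ C locΛ locN kap' KG KΓ KCs K₀ :=
  ⟨fun σ hσ => mono_rate hKG hle locΛ locN (h17.hG σ hσ), mono_rate hKΓ hle locΛ locN h17.hΓ₀,
    fun σ hσ => mono_rate hKCs hle locΛ locΛ (h17.hCs σ hσ), mono_rate hK₀ hle locΛ locΛ h17.hC216⟩

/-- `Differences216` persists at any smaller rate (non-negative constants). [cite: Balaban1988RG2Cluster, (2.16) p.16] -/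
theorem differences216_mono_rate {c : B13.Consts} {A : (TPt d N' → ℂ) → Matrix Λ Λ ℂ}
    {G : (TPt d N' → ℂ) → Matrix Λ (Λ ⊕ C₀) ℂ} {Γ₀ : Matrix Λ (Λ ⊕ C₀) ℝ} {C : Matrix Λ Λ ℝ} {locΛ : Λ → UT Nf}
    {locN : Λ ⊕ C₀ → UT Nf} {kap kap' θΓ θC θE : ℝ} (hle : kap' ≤ kap) (hθΓ : 0 ≤ θΓ) (hθC : 0 ≤ θC)
    (hθE : 0 ≤ θE) (h16 : Differences216 c A G Γ₀ C locΛ locN kap θΓ θC θE) :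
    Differences216 c A G Γ₀ C locΛ locN kap' θΓ θC θE :=
  ⟨fun σ hσ => mono_rate hθΓ hle locΛ locN (h16.hdΓ σ hσ), fun σ hσ => mono_rate hθC hle locΛ locΛ (h16.hdC σ hσ),
    fun σ hσ => mono_rate hθE hle locΛ locΛ (h16.hdE σ hσ)⟩

/-- **`Differences216` from TWO difference bounds** (the covariance field DERIVED): `Localisation17a` at rate `κ` (fields
`hCs`, `hC216`), the capstone's `hAs` ∕ `hA` (`A(σ)` symmetric, `Re A(σ) ≻ 0`) and `hC : C ≻ 0`, the Γ-kernel bound `hdΓ`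
(`θ_Γ`) and the PRECISION bound `hdE` (`θ_E`) at rate `κ`, `Z₀`'s bonds located `≤ m` per site ⟹ for `0 ≤ κ″ < κ′ < κ`,
`Differences216` at rate `κ″` with `θ_C = K_Cs·θ_E·(m(1+2/(κ−κ′))^ν)·K₀·(m(1+2/(κ′−κ″))^ν)` (covariance field by
`B13CovarianceDifference216.hdC_of_hdE`, the other two weakened to the smaller rate): given L17a, the (2.16)-type inputs
of (2.26) for one term are TWO asserted σ-difference bounds, not three. [cite: Balaban1988RG2Cluster, (2.16) p.16, p.15] -/
theorem differences216_of_two (c : B13.Consts) {A : (TPt d N' → ℂ) → Matrix Λ Λ ℂ}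
    {G : (TPt d N' → ℂ) → Matrix Λ (Λ ⊕ C₀) ℂ} {Γ₀ : Matrix Λ (Λ ⊕ C₀) ℝ} {C : Matrix Λ Λ ℝ} (hC : C.PosDef)
    (hAs : ∀ σ : TPt d N' → ℂ, (∀ j, ‖σ j‖ ≤ Real.exp c.κ₁) → (A σ).IsSymm)
    (hA : ∀ σ : TPt d N' → ℂ, (∀ j, ‖σ j‖ ≤ Real.exp c.κ₁) → ((A σ).map Complex.re).PosDef)
    (locΛ : Λ → UT Nf) (locN : Λ ⊕ C₀ → UT Nf) {m : ℕ}
    (hfibΛ : ∀ x : UT Nf, (Finset.univ.filter fun i => locΛ i = x).card ≤ m)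
    {kap kap' kap'' KG KΓ KCs K₀ θΓ θE : ℝ} (hkap'' : 0 ≤ kap'') (h1 : kap'' < kap') (h2 : kap' < kap)
    (hKCs : 0 ≤ KCs) (hK₀ : 0 ≤ K₀) (hθΓ : 0 ≤ θΓ) (hθE : 0 ≤ θE)
    (h17 : Localisation17a c A G Γ₀ C locΛ locN kap KG KΓ KCs K₀)
    (hdΓ : ∀ σ : TPt d N' → ℂ, (∀ j, ‖σ j‖ ≤ Real.exp c.κ₁) →
      ∀ b j, ‖(G σ - Γ₀.map (algebraMap ℝ ℂ)) b j‖ ≤ θΓ * Real.exp (-(kap * tdist1 Nf (locΛ b) (locN j))))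
    (hdE : ∀ σ : TPt d N' → ℂ, (∀ j, ‖σ j‖ ≤ Real.exp c.κ₁) →
      ∀ b b', ‖(A σ - C⁻¹.map (algebraMap ℝ ℂ)) b b'‖ ≤ θE * Real.exp (-(kap * tdist1 Nf (locΛ b) (locΛ b')))) :
    Differences216 c A G Γ₀ C locΛ locN kap'' θΓ
      (KCs * θE * (m * (1 + 2 / (kap - kap')) ^ ν) * K₀ * (m * (1 + 2 / (kap' - kap'')) ^ ν)) θE :=
  ⟨fun σ hσ => mono_rate hθΓ (h1.trans h2).le locΛ locN (hdΓ σ hσ),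
    hdC_of_hdE c.κ₁ A hC hAs hA locΛ hfibΛ hkap'' h1 h2 hKCs hK₀ hθE h17.hCs h17.hC216 hdE,
    fun σ hσ => mono_rate hθE (h1.trans h2).le locΛ locΛ (hdE σ hσ)⟩

end TwoFields

end

end Literature.MathematicalPhysics.QuantumFieldTheory.Balaban1983to89.B13PrimitiveKernels216
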